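import Summits.ResolutionOfSingularities.ResolutionOfSingularities.Theses.FrobeniusLadder
import Summits.ResolutionOfSingularities.ResolutionOfSingularities.Theorems.FInjectiveMacaulayfication.Negative.LoadBearing
import Summits.ResolutionOfSingularities.ResolutionOfSingularities.Theorems.FInjectiveMacaulayfication.Negative.CohenMacaulayNotFInjective

/-!
# Disproof of `FInjectiveMacaulayfication` — findings (standing disprover, cdisprove gen 1, cycle 1)

Crux `stmt-ResolutionOfSingularities-15315` =
`Summit.ResolutionOfSingularities.ResolutionOfSingularities.Theses.FrobeniusLadder.FInjectiveMacaulayfication`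
(route FrobeniusLadder, rank 2): for every prime `p`, field `k` of characteristic `p` and reduced
separated `k`-scheme `X` of finite type there is a proper birational `π : X' → X` with, at EVERY
point `x ∈ X'`: `𝒪_{X',x}` a domain, and for every `d = dim 𝒪_{X',x}` and every `s : Fin d → 𝒪`
with `rad (s)` maximal (a system of parameters): `s` weakly regular ("depth half") and `(s)`
Frobenius closed, inline `(∃ e, y^(p^e) ∈ span {z^(p^e) | z ∈ (s)}) → y ∈ (s)` ("Frobenius half").

VERDICT OF CYCLE 1: **no kill, and none is possible short of a counterexample to resolution of
singularities** (§1). Everything is `lean check`ed (rc 0, no `sorry`). The theorems LANDED (accepted)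
under `Theorems/FInjectiveMacaulayfication/Negative/`: `LoadBearing.lean` (p129270:
`exists_not_isDomain_stalk_of_isBirational_spec_dualNumber`,
`fInjectiveMacaulayfication_false_without_isReduced(_at)`,
`exists_stalk_ringEquiv_of_isBirational_spec_field`, `fInjectiveMacaulayfication_false_without_prime`,
`charP_stalk`, `rung_of_isRegular`, `conclusion_of_hasResolution`, `conclusion_of_dim_le_three`) and
`CohenMacaulayNotFInjective.lean` (p129375: `cusp_*`,
`fInjectiveMacaulayfication_depthHalf_not_imp_frobeniusHalf`) and `ParameterBlowupChart.lean`
(p129572: `fInjectiveMacaulayfication_parameterBlowupChart_not_frobeniusClosed`; cited, not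
imported — nothing below uses it); this work file imports the first two and adds
the `def` forms of the dropped-hypothesis variants and the summit-mentioning corollaries (which a
`Negative/` file may not state). IMPORT these modules in scratch checks / skeletons.

## §0 Reading of the statement (symbol by symbol; no mis-typing found)
* `IsBirational π` = some dense open `U ⊆ X` with dense preimage and `π ∣_ U` iso (Literature def);
  `IsProper` (Mathlib) includes `LocallyOfFiniteType`, so `X'` is of finite type over `k` — the
  per-stalk clause does not need to (and does not) say "Noetherian".
* `ringKrullDim … = d` with `d : ℕ` cast into `WithBot ℕ∞`; generic points (`d = 0`, `s = ()`,
  `(s) = ⊥`, radical `⊥` maximal in a field) satisfy the clause non-vacuously and correctly.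
* `y ^ p ^ e` parses `y ^ (p ^ e)`; `span ((· ^ p^e) '' (s))` IS the Frobenius power `(s)^[p^e]`
  in characteristic `p` (tree: `Literature.RingTheory.TightClosure.frobeniusPower_span`,
  `isFrobeniusClosed_iff` shows the clause is literally `IsFrobeniusClosed p (s)`).
* `IsWeaklyRegular R (List.ofFn s)` in the GIVEN order of `s`; harmless (the clause quantifies over
  all `s`, and in the intended CM situation every permutation of an s.o.p. is regular).
* No junk operators (`/`, `ℕ`-subtraction, `sSup`, `tsum` …); the only junk value is `p = 0`
  (`0 ^ e`), excluded by `p.Prime` (§2).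

## §1 WHY IT RESISTS (the decisive finding)
`fInjectiveMacaulayfication_of_resolutionOfSingularities : ResolutionOfSingularities → crux`
(and its contrapositive): a resolution IS an F-injective Macaulayfication — regular local rings are
domains, their s.o.p.'s are regular sequences (`RegularStalksClimb_proof`, in tree), all their
ideals are Frobenius closed (Kunz, `isFrobeniusClosed_of_isRegularLocalRing`, in tree), stalks of
`k`-schemes have characteristic `p` (`charP_stalk`). Consequences:
* a refutation of the crux in ANY characteristic is a problem decider (¬summit) — the route's kill
  criterion, now kernel-checked;
* `conclusion_of_dim_le_three`: modulo `CossartPiltant2019` the crux holds for `dim X ≤ 3`, so a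
  counterexample is a reduced variety of dimension `≥ 4` in characteristic `p` admitting NO
  proper birational locally-integral CM F-injective model; nothing of the kind is in print
  (searches: route Novelty section; this cycle: zbMATH/arXiv/OpenAlex "F-injective" × {blow-up,
  modification, Macaulayfication, Rees algebra, birational}, "Frobenius closure parameter ideal
  blow-up", "weakly normal Macaulayfication" — only HWY02-type results on Rees algebras OF
  F-rational/F-pure rings and Česnavičius' CM rung).
So the disprover's cheap attacks (small models, degenerate cases) cannot bite the crux as stated;
they bite only its HYPOTHESES (§2) and its NATURAL STRENGTHENINGS / proof shortcuts (§3).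

## §2 Load-bearing hypotheses (drop one at a time)
* `IsReduced X`: LOAD-BEARING — `fInjectiveMacaulayfication_false_without_isReduced` (witness
  `Spec 𝔽_p[ε]`: a birational source has a stalk `≅ 𝔽_p[ε]`-localised, not a domain). It enters a
  proof exactly through "locally integral".
* `p.Prime`: JUNK-ONLY — `fInjectiveMacaulayfication_false_without_prime` (at `p = 0` the inline
  clause degenerates to `1 ∈ (s)`; witness `X = Spec ℚ`). No content for a prover.
* `[CharP k p]`: cannot be dropped independently of `p.Prime` in a meaningful way (with `k = ℚ`,
  `p = 2` the clause `y² ∈ span {z²} = (s)² ⇒ y ∈ (s)` fails at every CM point of dimension `≥ 2`,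
  e.g. `y = uv`, `s = (u², v²)`; not formalised — junk direction).
* `LocallyOfFiniteType f`: STATUS OPEN here. NOT witnessed by the absolute integral closure
  `Spec 𝔽_p[X]⁺` (the witness used against `HasResolution` in sibling cruxes): that scheme is a
  one-dimensional perfect normal domain, and the IDENTITY satisfies the per-stalk clause (domain;
  `d ≤ 1`; a non-zero parameter is regular; `y^p ∈ (s^p)` ⇒ `(y/s)^p ∈ R` ⇒ `y/s ∈ R` by normality)
  — so the crux's conclusion, unlike `HasResolution`, does not force Noetherian stalks when
  properness over a finite-type base is absent. A genuine witness should be a two-dimensional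
  Noetherian local domain that is not CM-quasi-excellent (Ferrand–Raynaud / Nagata: no
  Macaulayfication exists, Česnavičius 2021 Rem. 1.7); far from the tree. Provers: the hypothesis
  is used (through excellence: openness of loci, finiteness of normalisation, Kawasaki's input).
* `IsSeparated f`, `QuasiCompact f`: PROBABLY REMOVABLE (resolution-type statements are local on
  `X` up to the usual gluing caveat); no witness attempted.
* Every hypothesis at once is consistent: non-vacuity is witnessed by `X = Spec k` or any regular
  `X` (`rung_of_isRegular` with `X' = X`).

## §3 Natural strengthenings / shortcuts REFUTED
* "depth half ⇒ Frobenius half" (CM ⇒ F-injective; = "any Macaulayfication is a witness"):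
  FALSE at every `p`, already for one-dimensional local domains essentially of finite type —
  `not_depthHalfImpFrobeniusHalf` (cusp `𝔽_p[T²,T³]` at the origin: `s = T²` weakly regular,
  `rad (T²) = 𝔪`, `(T³)^p ∈ (T²)^[p]`, `T³ ∉ (T²)`). The F-injective models of the cusp are its
  weak normalisation `Spec 𝔽_p[T]`: the modification must CHANGE the non-F-injective points.
* "the identity works for NORMAL Cohen–Macaulay `X`": FALSE — the route's own calibration item
  `CPSpecimenNotFClosed` (landed, `cpSpecimenNotFClosed_proof`): the normal hypersurface
  `Z^p + u₄u₁^p + u₃u₂^p` has `Z ∉ (u)` but `Z^p ∈ (u)^[p]`.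
* "a FINITE birational `π` suffices" (true in dimension 1: weak normalisation): FALSE from
  dimension 2 on — a normal non-F-injective surface point (e.g. `z² + x³ + y⁵` in characteristic
  `2, 3, 5`; Fedder: `f^{p-1} ∈ 𝔪^[p]`) has no finite birational models but itself. Not
  formalised (normality proofs are out of reach); recorded for the planner's `IsolatedFInjBlowup`.
* "ONE blow-up of a parameter ideal F-injectivises an isolated non-F-injective CM point" (the
  route's foreseen split `IsolatedFInjBlowup`, Kawasaki's engine verbatim): its obvious instance
  is FALSE (certified), and the ideators' Cartier-trace pigeonhole argues that EVERY parameter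
  centre fails (not certified here) — LANDED as `Negative/ParameterBlowupChart.lean` (p129572,
  `fInjectiveMacaulayfication_parameterBlowupChart_not_frobeniusClosed`): in the `y = xT` chart
  `A = k[x,T,z]/(z² + x³ + x⁵T⁵)` of the blow-up of `E₈⁰ : z² + x³ + y⁵` along the parameter
  ideal `(x, y)`, the parameter ideal `(x, T)` of the chart origin is not Frobenius closed for
  EVERY prime `p` (`z ∉ (x,T)`, `z^p ∈ (x,T)^[p]`; the whole exceptional curve `{x = z = 0}` is a
  transversal cusp — the "nilpotent wall" of the ideators, `NOTES-ideator1.md`; the picked line's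
  own no-go witness `stub_parameter_blowup_not_frobenius_closed` (p129192, lead prover) is the
  same chart with the HEIGHT-ONE ideal `(x)`: `z ∉ (x)`, `z^p ∈ (x^p)` — failure already in
  codimension one, i.e. non-normality of the blow-up). Since `E₈⁰` is
  F-regular for `p ≥ 7` and not F-injective for `p ≤ 5`, Kawasaki's move NEITHER CREATES NOR
  PRESERVES the Frobenius half: the class {locally integral, CM, F-injective} is not stable under
  blow-ups of parameter ideals, in any characteristic. A transplanted engine needs other centres
  (ideators: `ν ≥ c + 2` generators; weakly-normal / Cartier-contraction centres).
* (also in `CohenMacaulayNotFInjective.lean`'s docstring) the cusp is the codimension-one shadow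
  of the same wall.

## §4 Targets (lead's stubs, line `Sketch`, registered during cycle 1)
`stub_trapped_image`: true (pigeonhole) · `stub_kawasakiIntegral`: theorem in print (Kawasaki /
Česnavičius) · `stub_fInjectivize`: implied by the summit (`stub_fInjectivize_of_resolutionOfSingularities`
at the end of this file) and carries the whole crux. No stub is refutable; details in the §4 block below.

## §5 Near-misses
None claimed. (No `sorry` in this file.)
-/

noncomputable section

open CategoryTheory AlgebraicGeometry TopologicalSpace
open Literature.AlgebraicGeometry.Resolution Literature.RingTheory.TightClosure
open Summit.ResolutionOfSingularities.ResolutionOfSingularities.Theses.FrobeniusLadder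
open Summit.ResolutionOfSingularities.ResolutionOfSingularities.Theorems.FInjectiveMacaulayfication.Negative

set_option linter.dupNamespace false

namespace Summit.ResolutionOfSingularities.ResolutionOfSingularities.Cruxes.FInjectiveMacaulayfication.Disproof

/-! ## §1 Why it resists: the summit implies the crux -/

/-- **WHY IT RESISTS — the summit implies the crux** (take `X'` = a resolution; landed pieces:
`conclusion_of_hasResolution`, `rung_of_isRegular`, `charP_stalk`). [folklore] -/
theorem fInjectiveMacaulayfication_of_resolutionOfSingularities
    (hR : _root_.ResolutionOfSingularities) : FInjectiveMacaulayfication :=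
  fun p hp k _ _ X f hsep hft hqc hred =>
    conclusion_of_hasResolution hp f
      ((_root_.ResolutionOfSingularities_iff.mp hR) p hp k X f hsep hft hqc hred)

/-- Contrapositive: **a refutation of the crux is a problem decider** (¬summit). [folklore] -/
theorem not_resolutionOfSingularities_of_not_fInjectiveMacaulayfication
    (h : ¬ FInjectiveMacaulayfication) : ¬ _root_.ResolutionOfSingularities := fun hR =>
  h (fInjectiveMacaulayfication_of_resolutionOfSingularities hR)

/-- **Dimension `≤ 3` is settled** modulo `CossartPiltant2019` (landed:
`conclusion_of_dim_le_three`): restated here as "the crux restricted to `dim X ≤ 3` holds".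
[cite: CossartPiltant2019, Thm. 1.1] -/
theorem fInjectiveMacaulayfication_dim_le_three (hCP : CossartPiltant2019.{0}) :
    ∀ p : ℕ, p.Prime → ∀ (k : Type) [Field k] [CharP k p] (X : Scheme.{0})
      (f : X ⟶ Spec (.of k)), IsSeparated f → LocallyOfFiniteType f → QuasiCompact f →
      IsReduced X → topologicalKrullDim X ≤ 3 →
      ∃ (X' : Scheme.{0}) (π : X' ⟶ X), IsProper π ∧ IsBirational π ∧ ∀ x : X',
        IsDomain (X'.presheaf.stalk x) ∧ ∀ d : ℕ, ringKrullDim (X'.presheaf.stalk x) = d →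
          ∀ s : Fin d → X'.presheaf.stalk x, (Ideal.span (Set.range s)).radical.IsMaximal →
            RingTheory.Sequence.IsWeaklyRegular (X'.presheaf.stalk x) (List.ofFn s) ∧
            ∀ y : X'.presheaf.stalk x, (∃ e : ℕ, y ^ p ^ e ∈ Ideal.span
              ((fun z : X'.presheaf.stalk x => z ^ p ^ e) ''
                (Ideal.span (Set.range s) : Set (X'.presheaf.stalk x)))) →
              y ∈ Ideal.span (Set.range s) :=
  fun _ hp k _ _ X f hsep hft hqc hred hdim =>
    haveI := hsep; haveI := hft; haveI := hqc; haveI := hred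
    conclusion_of_dim_le_three hCP hp k X f hdim

/-- **Non-vacuity / consistency of the hypotheses and the conclusion**: a regular `X` (e.g.
`Spec k`, `𝔸ⁿ_k`) is its own F-injective Macaulayfication. [folklore] -/
theorem conclusion_of_isRegular {p : ℕ} (hp : p.Prime) {k : Type} [Field k] [CharP k p]
    {X : Scheme.{0}} (f : X ⟶ Spec (.of k)) (hX : Scheme.IsRegular X) :
    ∃ (X' : Scheme.{0}) (π : X' ⟶ X), IsProper π ∧ IsBirational π ∧ ∀ x : X',
      IsDomain (X'.presheaf.stalk x) ∧ ∀ d : ℕ, ringKrullDim (X'.presheaf.stalk x) = d →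
        ∀ s : Fin d → X'.presheaf.stalk x, (Ideal.span (Set.range s)).radical.IsMaximal →
          RingTheory.Sequence.IsWeaklyRegular (X'.presheaf.stalk x) (List.ofFn s) ∧
          ∀ y : X'.presheaf.stalk x, (∃ e : ℕ, y ^ p ^ e ∈ Ideal.span
            ((fun z : X'.presheaf.stalk x => z ^ p ^ e) ''
              (Ideal.span (Set.range s) : Set (X'.presheaf.stalk x)))) →
            y ∈ Ideal.span (Set.range s) :=
  conclusion_of_hasResolution hp f hX.hasResolution

/-! ## §2 Load-bearing hypotheses, `def` forms (theorems landed in `Negative/LoadBearing.lean`) -/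

/-- The crux with the hypothesis `IsReduced X` deleted (everything else verbatim). [folklore] -/
def FInjectiveMacaulayficationWithoutIsReduced : Prop :=
  ∀ p : ℕ, p.Prime → ∀ (k : Type) [Field k] [CharP k p] (X : Scheme.{0})
    (f : X ⟶ Spec (.of k)), IsSeparated f → LocallyOfFiniteType f → QuasiCompact f →
    ∃ (X' : Scheme.{0}) (π : X' ⟶ X), IsProper π ∧ IsBirational π ∧ ∀ x : X',
      IsDomain (X'.presheaf.stalk x) ∧ ∀ d : ℕ, ringKrullDim (X'.presheaf.stalk x) = d →
        ∀ s : Fin d → X'.presheaf.stalk x, (Ideal.span (Set.range s)).radical.IsMaximal →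
          RingTheory.Sequence.IsWeaklyRegular (X'.presheaf.stalk x) (List.ofFn s) ∧
          ∀ y : X'.presheaf.stalk x, (∃ e : ℕ, y ^ p ^ e ∈ Ideal.span
            ((fun z : X'.presheaf.stalk x => z ^ p ^ e) ''
              (Ideal.span (Set.range s) : Set (X'.presheaf.stalk x)))) →
            y ∈ Ideal.span (Set.range s)

/-- **`IsReduced X` is load-bearing**: witness `Spec 𝔽_p[ε]` (landed:
`fInjectiveMacaulayfication_false_without_isReduced`). [folklore] -/
theorem fInjectiveMacaulayfication_false_without_isReduced' :
    ¬ FInjectiveMacaulayficationWithoutIsReduced :=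
  fInjectiveMacaulayfication_false_without_isReduced

/-- The crux with `p.Prime →` deleted (everything else verbatim). [folklore] -/
def FInjectiveMacaulayficationWithoutPrime : Prop :=
  ∀ (p : ℕ) (k : Type) [Field k] [CharP k p] (X : Scheme.{0}) (f : X ⟶ Spec (.of k)),
    IsSeparated f → LocallyOfFiniteType f → QuasiCompact f → IsReduced X →
    ∃ (X' : Scheme.{0}) (π : X' ⟶ X), IsProper π ∧ IsBirational π ∧ ∀ x : X',
      IsDomain (X'.presheaf.stalk x) ∧ ∀ d : ℕ, ringKrullDim (X'.presheaf.stalk x) = d →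
        ∀ s : Fin d → X'.presheaf.stalk x, (Ideal.span (Set.range s)).radical.IsMaximal →
          RingTheory.Sequence.IsWeaklyRegular (X'.presheaf.stalk x) (List.ofFn s) ∧
          ∀ y : X'.presheaf.stalk x, (∃ e : ℕ, y ^ p ^ e ∈ Ideal.span
            ((fun z : X'.presheaf.stalk x => z ^ p ^ e) ''
              (Ideal.span (Set.range s) : Set (X'.presheaf.stalk x)))) →
            y ∈ Ideal.span (Set.range s)

/-- **`p.Prime` is (junk-)load-bearing**: at `p = 0` the inline clause degenerates; witness
`X = Spec ℚ` (landed: `fInjectiveMacaulayfication_false_without_prime`). [folklore] -/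
theorem fInjectiveMacaulayfication_false_without_prime' :
    ¬ FInjectiveMacaulayficationWithoutPrime :=
  fInjectiveMacaulayfication_false_without_prime

/-- The crux with `LocallyOfFiniteType f` deleted (everything else verbatim). STATUS: not decided
(module docstring §2: `Spec 𝔽_p[X]⁺` is NOT a witness — the identity satisfies the per-stalk
clause there; a genuine witness is a non-CM-quasi-excellent local surface, Ferrand–Raynaud).
[folklore] -/
def FInjectiveMacaulayficationWithoutLocallyOfFiniteType : Prop :=
  ∀ p : ℕ, p.Prime → ∀ (k : Type) [Field k] [CharP k p] (X : Scheme.{0})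
    (f : X ⟶ Spec (.of k)), IsSeparated f → QuasiCompact f → IsReduced X →
    ∃ (X' : Scheme.{0}) (π : X' ⟶ X), IsProper π ∧ IsBirational π ∧ ∀ x : X',
      IsDomain (X'.presheaf.stalk x) ∧ ∀ d : ℕ, ringKrullDim (X'.presheaf.stalk x) = d →
        ∀ s : Fin d → X'.presheaf.stalk x, (Ideal.span (Set.range s)).radical.IsMaximal →
          RingTheory.Sequence.IsWeaklyRegular (X'.presheaf.stalk x) (List.ofFn s) ∧
          ∀ y : X'.presheaf.stalk x, (∃ e : ℕ, y ^ p ^ e ∈ Ideal.span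
            ((fun z : X'.presheaf.stalk x => z ^ p ^ e) ''
              (Ideal.span (Set.range s) : Set (X'.presheaf.stalk x)))) →
            y ∈ Ideal.span (Set.range s)

/-! ## §3 Natural strengthening refuted, `def` form (theorem landed in
`Negative/CohenMacaulayNotFInjective.lean`) -/

/-- The shortcut "every weakly regular s.o.p. of a Noetherian local domain of characteristic `p`
generates a Frobenius closed ideal" (= "Cohen–Macaulay ⇒ F-injective"; with Macaulayfication it
would prove the crux). [folklore] -/
def DepthHalfImpFrobeniusHalf (p : ℕ) : Prop :=
  ∀ (R : Type) [CommRing R] [IsDomain R] [IsNoetherianRing R] [IsLocalRing R] [CharP R p]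
    (d : ℕ) (s : Fin d → R), (Ideal.span (Set.range s)).radical.IsMaximal →
    RingTheory.Sequence.IsWeaklyRegular R (List.ofFn s) →
    ∀ y : R, (∃ e : ℕ, y ^ p ^ e ∈ Ideal.span ((fun z : R => z ^ p ^ e) ''
      (Ideal.span (Set.range s) : Set R))) → y ∈ Ideal.span (Set.range s)

/-- **"CM ⇒ F-injective" is false at every prime** (cusp `𝔽_p[T², T³]` at the origin, `s = T²`,
`y = T³`; landed: `fInjectiveMacaulayfication_depthHalf_not_imp_frobeniusHalf`). [folklore] -/
theorem not_depthHalfImpFrobeniusHalf (p : ℕ) [Fact p.Prime] : ¬ DepthHalfImpFrobeniusHalf p :=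
  fInjectiveMacaulayfication_depthHalf_not_imp_frobeniusHalf p

/-! ## §4 Targets — the picked line `Sketch` (skeleton 4646e6fa…, lead `prover-line-…-15315-0`)

Stubs registered on the item at the end of cycle 1 and the disprover's assessment:
* `stub_trapped_image` (Cartier pigeonhole `T(I^{pn+(ν-1)(p-1)}) ⊆ Iⁿ·T(R)` for a `p⁻¹`-linear
  `T`): TRUE, elementary — every monomial `g^a` with `|a| = pn + (ν-1)(p-1)` factors as
  `(g^b)^p g^r` with `|b| ≥ n` (since `p Σ⌊aᵢ/p⌋ ≥ |a| - ν(p-1) > p(n-1)`), and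
  `T((g^b)^p g^r c) = g^b T(g^r c)`; no `ℕ`-subtraction junk (`ν = 0`: `I = ⊥`; `p ≥ 2`). Not a
  target for refutation.
* `stub_kawasakiIntegral` (Macaulayfication of integral varieties, every field): a THEOREM in print
  (Kawasaki 2000 Thm. 1.1; Česnavičius 2021 Thm. 1.6) — not refutable; its cost is formalisation.
* `stub_fInjectivize` (the crux for locally-integral CM input): implied by the summit exactly like
  the crux (`stub_fInjectivize_of_resolutionOfSingularities` below: stalks domains ⇒ `X₁` reduced
  ⇒ resolve ⇒ `conclusion_of_hasResolution`), hence NOT refutable short of ¬summit; and by §3 its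
  CM hypothesis cannot be USED pointwise (CM ⇏ F-injective; parameter blow-ups do not help), so a
  proof must contain a genuinely new modification engine — this stub carries the whole crux.

## §5 Near-misses: none (no `sorry`). -/

/-- **Target `stub_fInjectivize` resists like the crux: the summit implies it** (stalks domains ⇒
`X₁` reduced, `isReduced_of_isReduced_stalk`; then a resolution of `X₁` is a witness,
`conclusion_of_hasResolution`). The statement below is the registered stub signature verbatim,
behind the hypothesis `ResolutionOfSingularities`. [folklore] -/
theorem stub_fInjectivize_of_resolutionOfSingularities (hR : _root_.ResolutionOfSingularities) :
    ∀ (p : ℕ), p.Prime → ∀ (k : Type) [Field k] [CharP k p] (X₁ : Scheme.{0})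
      (f₁ : X₁ ⟶ Spec (.of k)), IsSeparated f₁ → LocallyOfFiniteType f₁ → QuasiCompact f₁ →
      (∀ x : X₁, IsDomain (X₁.presheaf.stalk x) ∧ ∀ d : ℕ, ringKrullDim (X₁.presheaf.stalk x) = d →
        ∀ s : Fin d → X₁.presheaf.stalk x, (Ideal.span (Set.range s)).radical.IsMaximal →
          RingTheory.Sequence.IsWeaklyRegular (X₁.presheaf.stalk x) (List.ofFn s)) →
      ∃ (X' : Scheme.{0}) (π : X' ⟶ X₁), IsProper π ∧ IsBirational π ∧ ∀ x : X',
        IsDomain (X'.presheaf.stalk x) ∧ ∀ d : ℕ, ringKrullDim (X'.presheaf.stalk x) = d →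
          ∀ s : Fin d → X'.presheaf.stalk x, (Ideal.span (Set.range s)).radical.IsMaximal →
            RingTheory.Sequence.IsWeaklyRegular (X'.presheaf.stalk x) (List.ofFn s) ∧
            ∀ y : X'.presheaf.stalk x, (∃ e : ℕ, y ^ p ^ e ∈ Ideal.span
              ((fun z : X'.presheaf.stalk x => z ^ p ^ e) ''
                (Ideal.span (Set.range s) : Set (X'.presheaf.stalk x)))) →
              y ∈ Ideal.span (Set.range s) := by
  intro p hp k _ _ X₁ f₁ hsep hft hqc hCM
  haveI : ∀ x : X₁, IsDomain (X₁.presheaf.stalk x) := fun x => (hCM x).1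
  haveI : IsReduced X₁ := isReduced_of_isReduced_stalk X₁
  exact conclusion_of_hasResolution hp f₁
    ((_root_.ResolutionOfSingularities_iff.mp hR) p hp k X₁ f₁ hsep hft hqc inferInstance)


end Summit.ResolutionOfSingularities.ResolutionOfSingularities.Cruxes.FInjectiveMacaulayfication.Disproof

end
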